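import Literature.NumberTheory.Sieve.BombieriFriedlanderIwaniecErrorTerms
import Literature.NumberTheory.Sieve.BombieriFriedlanderIwaniecInterior
import HarnessLib

/-!
# Bombieri–Friedlander–Iwaniec 1986, Theorem 10: the assembly from the printed leaves

Topic `Literature/NumberTheory/Sieve`, the top of the DAG under the named fact
`Literature.NumberTheory.Sieve.bfi_wellFactorable_level` (BFI 1986, Theorem 10: the primes have
well-factorable level `x^{4/7−ε}`).  Everything here is PROVED.  Inputs (all PROVED in the
companion files): the reduction to the dyadic and sifted forms (`…Dyadic`), Heath-Brown's identity
applied to the sifted sum (`…Decomposition`), the partition into box-tuples (`…Partition`), the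
trivially bounded parts (`…ErrorTerms`) and the interior tuples (`…Interior`, which dispatches to
Theorems 1, 2, 5*, 0 (b) of the source along §17).  Result:

* `Literature.NumberTheory.Sieve.BFI.sifted_sum_bound` — BFI (15.1) for the weights of Theorem 10
  with `z = exp(√log x)`, `0 < ε ≤ 1/1000`: `|∑_{q ≤ x^{4/7−ε}, (q,a)=1} λ(q) E_z(x;q,a)| ≤ C x (log x)^{−A}`
  (parameters `Δ = (log x)^{−A₁}`, `U = 2⌈x^{1/7}⌉`, `K = ⌊2 log 2x / Δ⌋ + 1`, see `eventually_params`);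
* `Literature.NumberTheory.Sieve.BFI.Theorem10DyadicSifted_of_leaves`,
  `Literature.NumberTheory.Sieve.Theorem10Dyadic_of_leaves`,
  `Literature.NumberTheory.Sieve.BombieriFriedlanderIwaniecTheorem10_of_leaves`, and
* `Literature.NumberTheory.Sieve.bfi_wellFactorable_level_of_leaves` —
  `bfi_wellFactorable_level` from the named facts
  `BombieriFriedlanderIwaniecTheorem1`, `…Theorem2`, `…Theorem0b`, `…Theorem5StarInterval`,
  `…Lemma3` (BFI 1986, deep: dispersion method and Deshouillers–Iwaniec), `Shiu1980BrunTitchmarsh`,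
  `LFunctions.SiegelWalfiszMoebius`, `SieveSequence.fundamental_lemma_uniform` and
  `LFunctions.ChebyshevPsiDeLaValleePoussin` (classical).  The tree's fact is thus CONDITIONAL
  exactly on these printed theorems (D-0014); discharging it unconditionally would require
  formalising the dispersion method and the spectral theory of Kloosterman sums.

## References

* E. Bombieri, J. B. Friedlander, H. Iwaniec, *Primes in arithmetic progressions to large moduli*,
  Acta Math. 156 (1986), 203–251, §15 (15.1) p. 244, §17 p. 249, Theorem 10 p. 209.
  [BombieriFriedlanderIwaniecActa1986]
-/

open Finset Real

namespace Literature.NumberTheory.Sieve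
namespace BFI

/-- **The finite-sum skeleton of §15** (abstract): if `S(q) = ∑_κ (c_κ A_κ(q) + E_κ(q))` with
`0 ≤ c_κ ≤ L_c`, `|λ| ≤ 1`, the "interior" `κ` obey `|∑_q λ(q) A_κ(q)| ≤ B_I`, the others
`∑_q ∑_{κ not interior} |A_κ(q)| ≤ B_N`, and `∑_q ∑_κ |E_κ(q)| ≤ B_E`, then
`|∑_q λ(q) S(q)| ≤ #T · L_c · B_I + L_c · B_N + B_E`. [folklore] -/
theorem abstract_piece_sum_bound {K : Type*} (F : Finset ℕ) (T : Finset K) (pI : K → Prop)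
    [DecidablePred pI] (lam S : ℕ → ℝ) (A E : K → ℕ → ℝ) (c : K → ℝ) {BI BN BE Lc : ℝ}
    (hlam : ∀ q, |lam q| ≤ 1) (hS : ∀ q ∈ F, S q = ∑ κ ∈ T, (c κ * A κ q + E κ q))
    (hc0 : ∀ κ ∈ T, 0 ≤ c κ) (hc1 : ∀ κ ∈ T, c κ ≤ Lc) (hLc0 : 0 ≤ Lc)
    (hI : ∀ κ ∈ T, pI κ → |∑ q ∈ F, lam q * A κ q| ≤ BI) (hBI : 0 ≤ BI)
    (hN : ∑ q ∈ F, ∑ κ ∈ T.filter (fun κ => ¬ pI κ), |A κ q| ≤ BN)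
    (hE : ∑ q ∈ F, ∑ κ ∈ T, |E κ q| ≤ BE) :
    |∑ q ∈ F, lam q * S q| ≤ T.card * Lc * BI + Lc * BN + BE := by
  -- expand
  have hexp : ∑ q ∈ F, lam q * S q =
      (∑ κ ∈ T, c κ * ∑ q ∈ F, lam q * A κ q) + ∑ q ∈ F, ∑ κ ∈ T, lam q * E κ q := by
    calc ∑ q ∈ F, lam q * S q = ∑ q ∈ F, ∑ κ ∈ T, (c κ * (lam q * A κ q) + lam q * E κ q) := by
          refine Finset.sum_congr rfl fun q hq => ?_
          rw [hS q hq, Finset.mul_sum]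
          exact Finset.sum_congr rfl fun κ _ => by ring
      _ = (∑ q ∈ F, ∑ κ ∈ T, c κ * (lam q * A κ q)) + ∑ q ∈ F, ∑ κ ∈ T, lam q * E κ q := by
          rw [← Finset.sum_add_distrib]
          exact Finset.sum_congr rfl fun q _ => Finset.sum_add_distrib
      _ = _ := by
          congr 1
          rw [Finset.sum_comm]
          exact Finset.sum_congr rfl fun κ _ => by rw [Finset.mul_sum]
  rw [hexp]
  refine (abs_add_le _ _).trans (add_le_add ?_ ?_)
  · -- the main products
    calc |∑ κ ∈ T, c κ * ∑ q ∈ F, lam q * A κ q|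
        ≤ ∑ κ ∈ T, c κ * |∑ q ∈ F, lam q * A κ q| := by
          refine (Finset.abs_sum_le_sum_abs _ _).trans (Finset.sum_le_sum fun κ hκ => ?_)
          rw [abs_mul, abs_of_nonneg (hc0 κ hκ)]
      _ = (∑ κ ∈ T.filter pI, c κ * |∑ q ∈ F, lam q * A κ q|) +
            ∑ κ ∈ T.filter (fun κ => ¬ pI κ), c κ * |∑ q ∈ F, lam q * A κ q| :=
          (Finset.sum_filter_add_sum_filter_not T pI _).symm
      _ ≤ (∑ κ ∈ T.filter pI, Lc * BI) +
            ∑ κ ∈ T.filter (fun κ => ¬ pI κ), Lc * ∑ q ∈ F, |A κ q| := by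
          refine add_le_add (Finset.sum_le_sum fun κ hκ => ?_) (Finset.sum_le_sum fun κ hκ => ?_)
          · rw [Finset.mem_filter] at hκ
            exact mul_le_mul (hc1 κ hκ.1) (hI κ hκ.1 hκ.2) (abs_nonneg _) ((hc0 κ hκ.1).trans (hc1 κ hκ.1))
          · rw [Finset.mem_filter] at hκ
            refine mul_le_mul (hc1 κ hκ.1) ?_ (abs_nonneg _) ((hc0 κ hκ.1).trans (hc1 κ hκ.1))
            refine (Finset.abs_sum_le_sum_abs _ _).trans (Finset.sum_le_sum fun q _ => ?_)
            rw [abs_mul]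
            exact (mul_le_mul_of_nonneg_right (hlam q) (abs_nonneg _)).trans (by rw [one_mul])
      _ ≤ T.card * Lc * BI + Lc * BN := by
          refine add_le_add ?_ ?_
          · rw [Finset.sum_const, nsmul_eq_mul]
            calc ((T.filter pI).card : ℝ) * (Lc * BI) ≤ T.card * (Lc * BI) := by
                  refine mul_le_mul_of_nonneg_right ?_ (mul_nonneg hLc0 hBI)
                  exact_mod_cast Finset.card_filter_le _ _
              _ = T.card * Lc * BI := by ring
          · rw [← Finset.mul_sum]
            refine mul_le_mul_of_nonneg_left ?_ hLc0
            rw [Finset.sum_comm]; exact hN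
  · -- the error products
    calc |∑ q ∈ F, ∑ κ ∈ T, lam q * E κ q| ≤ ∑ q ∈ F, ∑ κ ∈ T, |E κ q| := by
          refine (Finset.abs_sum_le_sum_abs _ _).trans (Finset.sum_le_sum fun q _ => ?_)
          refine (Finset.abs_sum_le_sum_abs _ _).trans (Finset.sum_le_sum fun κ _ => ?_)
          rw [abs_mul]
          exact (mul_le_mul_of_nonneg_right (hlam q) (abs_nonneg _)).trans (by rw [one_mul])
      _ ≤ BE := hE

end BFI
end Literature.NumberTheory.Sieve

namespace Literature.NumberTheory.Sieve
namespace BFI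

/-- **The parameters of §15 for large `x`.**  With `L = log x`, `Δ = L^{−A₁}` (`A₁ ≥ 1`),
`U = 2⌈x^{1/7}⌉` and `K = ⌊2 log(2x)/Δ⌋ + 1`: for `x ≥ x₀(A₁)` one has `2 ≤ x`, `1 ≤ L`,
`log 2x ≤ 2L`, `0 < Δ`, `28Δ ≤ 1`, `x^{−1/5} ≤ Δ`, `1 ≤ U ≤ 4x^{1/7}`, `⌊2x⌋ ≤ U⁷`,
`2x < (1+Δ)^K` and `K ≤ 5 L^{A₁+1}`. [folklore] -/
theorem eventually_params {A₁ : ℝ} (hA₁ : 1 ≤ A₁) :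
    ∃ x₀ : ℝ, ∀ x : ℝ, x₀ ≤ x →
      2 ≤ x ∧ 1 ≤ Real.log x ∧ Real.log (2 * x) ≤ 2 * Real.log x ∧
      0 < Real.log x ^ (-A₁) ∧ 28 * Real.log x ^ (-A₁) ≤ 1 ∧ x ^ (-(1 / 5 : ℝ)) ≤ Real.log x ^ (-A₁) ∧
      (1 : ℕ) ≤ 2 * ⌈x ^ (1 / 7 : ℝ)⌉₊ ∧ ((2 * ⌈x ^ (1 / 7 : ℝ)⌉₊ : ℕ) : ℝ) ≤ 4 * x ^ (1 / 7 : ℝ) ∧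
      ⌊2 * x⌋₊ ≤ (2 * ⌈x ^ (1 / 7 : ℝ)⌉₊) ^ 7 ∧
      2 * x < (1 + Real.log x ^ (-A₁)) ^ (⌊2 * Real.log (2 * x) / Real.log x ^ (-A₁)⌋₊ + 1) ∧
      ((⌊2 * Real.log (2 * x) / Real.log x ^ (-A₁)⌋₊ + 1 : ℕ) : ℝ) ≤ 5 * Real.log x ^ (A₁ + 1) := by
  obtain ⟨Cp, hCp, hp⟩ := exists_log_rpow_le_rpow (show (0:ℝ) ≤ A₁ by linarith) (show (0:ℝ) < 1 / 10 by norm_num)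
  refine ⟨max (Real.exp 28) (Cp ^ (10 : ℕ)), fun x hx => ?_⟩
  have hxe : Real.exp 28 ≤ x := le_trans (le_max_left _ _) hx
  have hxC : Cp ^ (10 : ℕ) ≤ x := le_trans (le_max_right _ _) hx
  have hx0 : 0 < x := (Real.exp_pos 28).trans_le hxe
  set L : ℝ := Real.log x with hL
  have hL28 : 28 ≤ L := by rw [hL, Real.le_log_iff_exp_le hx0]; exact hxe
  have hL1 : 1 ≤ L := by linarith
  have hL0 : 0 < L := by linarith
  have hx2 : 2 ≤ x := by
    have : (2 : ℝ) ≤ Real.exp 28 := by have := Real.add_one_le_exp (28:ℝ); linarith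
    linarith
  have hx1 : 1 ≤ x := by linarith
  have hlog2x : Real.log (2 * x) ≤ 2 * L := by
    rw [Real.log_mul (by norm_num) hx0.ne', ← hL]
    have : Real.log 2 ≤ L := by rw [hL]; exact Real.log_le_log (by norm_num) hx2
    linarith
  -- `Δ`
  set Δ : ℝ := L ^ (-A₁) with hΔ
  have hΔ0 : 0 < Δ := Real.rpow_pos_of_pos hL0 _
  have hLA : L ≤ L ^ A₁ := by
    calc L = L ^ (1 : ℝ) := (Real.rpow_one L).symm
      _ ≤ L ^ A₁ := Real.rpow_le_rpow_of_exponent_le hL1 hA₁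
  have hΔ28 : 28 * Δ ≤ 1 := by
    rw [hΔ, Real.rpow_neg hL0.le, ← div_eq_mul_inv, div_le_one (Real.rpow_pos_of_pos hL0 _)]
    linarith
  have hΔx : x ^ (-(1 / 5 : ℝ)) ≤ Δ := by
    -- `L^{A₁} ≤ Cp x^{1/10} ≤ x^{1/5}` (as `x^{1/10} ≥ Cp`)
    have h1 : L ^ A₁ ≤ x ^ (1 / 5 : ℝ) := by
      refine (hp x hx1).trans ?_
      have h2 : Cp ≤ x ^ (1 / 10 : ℝ) := by
        have h3 : (Cp ^ (10 : ℕ)) ^ (1 / 10 : ℝ) ≤ x ^ (1 / 10 : ℝ) :=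
          Real.rpow_le_rpow (by positivity) hxC (by norm_num)
        rwa [← Real.rpow_natCast, ← Real.rpow_mul hCp.le, show ((10 : ℕ) : ℝ) * (1 / 10) = 1 by norm_num,
          Real.rpow_one] at h3
      calc Cp * x ^ (1 / 10 : ℝ) ≤ x ^ (1 / 10 : ℝ) * x ^ (1 / 10 : ℝ) :=
            mul_le_mul_of_nonneg_right h2 (Real.rpow_nonneg hx0.le _)
        _ = x ^ (1 / 5 : ℝ) := by rw [← Real.rpow_add hx0]; norm_num
    rw [hΔ, Real.rpow_neg hL0.le, Real.rpow_neg hx0.le]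
    exact inv_anti₀ (Real.rpow_pos_of_pos hL0 _) h1
  -- `U`
  set t : ℝ := x ^ (1 / 7 : ℝ) with ht
  have ht1 : 1 ≤ t := Real.one_le_rpow hx1 (by norm_num)
  have hceil : t ≤ ⌈t⌉₊ := Nat.le_ceil t
  have hceil' : (⌈t⌉₊ : ℝ) < t + 1 := Nat.ceil_lt_add_one (by linarith)
  have hU1 : (1 : ℕ) ≤ 2 * ⌈t⌉₊ := by
    have : 1 ≤ ⌈t⌉₊ := Nat.one_le_iff_ne_zero.2 (by
      intro h; have := hceil; rw [h] at this; simp at this; linarith)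
    omega
  have hU4 : ((2 * ⌈t⌉₊ : ℕ) : ℝ) ≤ 4 * t := by push_cast; linarith
  have hU7 : ⌊2 * x⌋₊ ≤ (2 * ⌈t⌉₊) ^ 7 := by
    have h1 : (⌊2 * x⌋₊ : ℝ) ≤ 2 * x := Nat.floor_le (by linarith)
    have h2 : (2 * x : ℝ) ≤ ((2 * ⌈t⌉₊ : ℕ) : ℝ) ^ 7 := by
      have h3 : t ^ 7 = x := by
        rw [ht, ← Real.rpow_natCast, ← Real.rpow_mul hx0.le]; norm_num
      have h4 : (2 * t) ^ 7 ≤ ((2 * ⌈t⌉₊ : ℕ) : ℝ) ^ 7 := by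
        refine pow_le_pow_left₀ (by linarith) ?_ 7
        push_cast; linarith
      have h5 : 2 * x ≤ (2 * t) ^ 7 := by rw [mul_pow, h3]; norm_num; linarith
      exact h5.trans h4
    exact_mod_cast h1.trans h2
  -- `K`
  set M₂ : ℝ := 2 * Real.log (2 * x) / Δ with hM₂
  have hM₂0 : 0 ≤ M₂ := by
    rw [hM₂]; exact div_nonneg (mul_nonneg (by norm_num) (Real.log_nonneg (by linarith))) hΔ0.le
  have hKgt : M₂ < (⌊M₂⌋₊ + 1 : ℕ) := by push_cast; exact Nat.lt_floor_add_one M₂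
  have hKpow : 2 * x < (1 + Δ) ^ (⌊M₂⌋₊ + 1) := by
    -- `(1+Δ)^K = exp(K log(1+Δ)) ≥ exp(K Δ/2) > exp(log 2x)`
    have hlog1Δ : Δ / 2 ≤ Real.log (1 + Δ) := by
      have h1 := Real.one_sub_inv_le_log_of_pos (show 0 < 1 + Δ by linarith)
      have h2 : Δ / 2 ≤ 1 - (1 + Δ)⁻¹ := by
        rw [show 1 - (1 + Δ)⁻¹ = Δ / (1 + Δ) by field_simp; ring]
        exact div_le_div_of_nonneg_left hΔ0.le (by linarith) (by linarith)
      linarith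
    have h3 : Real.log (2 * x) < ((⌊M₂⌋₊ + 1 : ℕ) : ℝ) * Real.log (1 + Δ) := by
      have h4 : Real.log (2 * x) = M₂ * (Δ / 2) := by rw [hM₂]; field_simp
      rw [h4]
      calc M₂ * (Δ / 2) < ((⌊M₂⌋₊ + 1 : ℕ) : ℝ) * (Δ / 2) := mul_lt_mul_of_pos_right hKgt (by linarith)
        _ ≤ ((⌊M₂⌋₊ + 1 : ℕ) : ℝ) * Real.log (1 + Δ) := mul_le_mul_of_nonneg_left hlog1Δ (Nat.cast_nonneg _)
    calc 2 * x = Real.exp (Real.log (2 * x)) := (Real.exp_log (by linarith)).symm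
      _ < Real.exp (((⌊M₂⌋₊ + 1 : ℕ) : ℝ) * Real.log (1 + Δ)) := Real.exp_lt_exp.2 h3
      _ = (1 + Δ) ^ (⌊M₂⌋₊ + 1) := by rw [← Real.log_pow, Real.exp_log (pow_pos (by linarith) _)]
  have hKle : ((⌊M₂⌋₊ + 1 : ℕ) : ℝ) ≤ 5 * L ^ (A₁ + 1) := by
    have h1 : ((⌊M₂⌋₊ + 1 : ℕ) : ℝ) ≤ M₂ + 1 := by push_cast; linarith [Nat.floor_le hM₂0]
    have h2 : M₂ ≤ 4 * L ^ (A₁ + 1) := by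
      rw [hM₂, hΔ, Real.rpow_neg hL0.le, div_inv_eq_mul, Real.rpow_add hL0, Real.rpow_one]
      nlinarith [Real.rpow_nonneg hL0.le A₁]
    have h3 : 1 ≤ L ^ (A₁ + 1) := Real.one_le_rpow hL1 (by linarith)
    linarith
  exact ⟨hx2, hL1, hlog2x, hΔ0, hΔ28, hΔx, hU1, hU4, hU7, hKpow, hKle⟩

end BFI
end Literature.NumberTheory.Sieve

namespace Literature.NumberTheory.Sieve
namespace BFI

/-- The exponent bookkeeping of the per-piece bound: with `L ≥ 1`, `Δ = L^{−A₁}`,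
`A₁ = A + max B_E B_N + 3`, `A₅ = A + 14(A₁+1) + 3`, `T_c ≤ 5^{14} L^{14(A₁+1)}`, `L_c ≤ 2L`:
`T_c L_c (C_I x L^{−A₅}) + L_c (C_N Δ x L^{B_N}) + C_E Δ x L^{B_E} ≤ (2·5^{14} C_I + 2 C_N + C_E) x L^{−A}`.
[folklore] -/
theorem perj_algebra {A BE BN CI CN CE L x Tc Lc : ℝ} (hL : 1 ≤ L) (hx : 0 ≤ x)
    (hCI : 0 ≤ CI) (hCN : 0 ≤ CN) (hCE : 0 ≤ CE)
    (hTc : Tc ≤ 5 ^ 14 * L ^ (14 * ((A + max BE BN + 3) + 1)))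
    (hLc0 : 0 ≤ Lc) (hLc : Lc ≤ 2 * L) :
    Tc * Lc * (CI * x / L ^ (A + 14 * ((A + max BE BN + 3) + 1) + 3)) +
      Lc * (CN * L ^ (-(A + max BE BN + 3)) * x * L ^ BN) +
      CE * L ^ (-(A + max BE BN + 3)) * x * L ^ BE ≤
    (2 * 5 ^ 14 * CI + 2 * CN + CE) * x / L ^ A := by
  have hL0 : 0 < L := by linarith
  set A₁ : ℝ := A + max BE BN + 3 with hA₁
  set A₅ : ℝ := A + 14 * (A₁ + 1) + 3 with hA₅
  have hmax1 : BE ≤ max BE BN := le_max_left _ _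
  have hmax2 : BN ≤ max BE BN := le_max_right _ _
  have hxL : 0 ≤ x / L ^ A := div_nonneg hx (Real.rpow_nonneg hL0.le _)
  -- the three monomials in `L`
  have e1 : L ^ (14 * (A₁ + 1)) * L * (L ^ A₅)⁻¹ ≤ (L ^ A)⁻¹ := by
    rw [← Real.rpow_neg hL0.le, ← Real.rpow_neg hL0.le, show L ^ (14 * (A₁ + 1)) * L = L ^ (14 * (A₁ + 1) + 1) by
      rw [Real.rpow_add hL0, Real.rpow_one], ← Real.rpow_add hL0]
    exact Real.rpow_le_rpow_of_exponent_le hL (by rw [hA₅]; linarith)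
  have e2 : L * (L ^ (-A₁) * L ^ BN) ≤ (L ^ A)⁻¹ := by
    have h1 : L * (L ^ (-A₁) * L ^ BN) = L ^ (1 + (-A₁ + BN)) := by
      rw [Real.rpow_add hL0, Real.rpow_one, Real.rpow_add hL0]
    rw [h1, ← Real.rpow_neg hL0.le]
    exact Real.rpow_le_rpow_of_exponent_le hL (by rw [hA₁]; linarith)
  have e3 : L ^ (-A₁) * L ^ BE ≤ (L ^ A)⁻¹ := by
    rw [← Real.rpow_neg hL0.le, ← Real.rpow_add hL0]
    exact Real.rpow_le_rpow_of_exponent_le hL (by rw [hA₁]; linarith)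
  have t1 : Tc * Lc * (CI * x / L ^ A₅) ≤ 2 * 5 ^ 14 * CI * (x / L ^ A) := by
    calc Tc * Lc * (CI * x / L ^ A₅) ≤ (5 ^ 14 * L ^ (14 * (A₁ + 1))) * (2 * L) * (CI * x / L ^ A₅) :=
          mul_le_mul (mul_le_mul hTc hLc hLc0 (by positivity)) le_rfl
            (div_nonneg (mul_nonneg hCI hx) (Real.rpow_nonneg hL0.le _)) (by positivity)
      _ = 2 * 5 ^ 14 * CI * x * (L ^ (14 * (A₁ + 1)) * L * (L ^ A₅)⁻¹) := by ring
      _ ≤ 2 * 5 ^ 14 * CI * x * (L ^ A)⁻¹ := mul_le_mul_of_nonneg_left e1 (by positivity)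
      _ = _ := by ring
  have t2 : Lc * (CN * L ^ (-A₁) * x * L ^ BN) ≤ 2 * CN * (x / L ^ A) := by
    calc Lc * (CN * L ^ (-A₁) * x * L ^ BN) ≤ (2 * L) * (CN * L ^ (-A₁) * x * L ^ BN) :=
          mul_le_mul_of_nonneg_right hLc (by positivity)
      _ = 2 * CN * x * (L * (L ^ (-A₁) * L ^ BN)) := by ring
      _ ≤ 2 * CN * x * (L ^ A)⁻¹ := mul_le_mul_of_nonneg_left e2 (by positivity)
      _ = _ := by ring
  have t3 : CE * L ^ (-A₁) * x * L ^ BE ≤ CE * (x / L ^ A) := by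
    calc CE * L ^ (-A₁) * x * L ^ BE = CE * x * (L ^ (-A₁) * L ^ BE) := by ring
      _ ≤ CE * x * (L ^ A)⁻¹ := mul_le_mul_of_nonneg_left e3 (by positivity)
      _ = _ := by ring
  calc _ ≤ 2 * 5 ^ 14 * CI * (x / L ^ A) + 2 * CN * (x / L ^ A) + CE * (x / L ^ A) := add_le_add (add_le_add t1 t2) t3
    _ = (2 * 5 ^ 14 * CI + 2 * CN + CE) * x / L ^ A := by ring

end BFI
end Literature.NumberTheory.Sieve

namespace Literature.NumberTheory.Sieve
namespace BFI

/-- `C(7, j) ≤ 35`. [folklore] -/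
theorem choose_seven_le (j : ℕ) : (Nat.choose 7 j : ℝ) ≤ 35 := by
  rcases le_or_gt j 7 with h | h
  · interval_cases j <;> simp [Nat.choose] <;> norm_num
  · rw [Nat.choose_eq_zero_of_lt h]; norm_num

/-- **The sifted dyadic sum for a small `ε`** (`0 < ε ≤ 1/1000`): for `a ≠ 0`, `A > 0` there are
`C, x₀` with `|∑_{q ≤ x^{4/7−ε}, (q,a)=1} λ(q) E_z(x; q, a)| ≤ C x (log x)^{−A}` for all `x ≥ x₀` and
all well-factorable `λ` of level `x^{4/7−ε}`, `z = exp(√log x)` — BFI (15.1) for the weights of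
Theorem 10, assembled from Heath-Brown's identity (`dyadDiscSifted_eq_sum_hbPiece`), the boxes
(`sievedDisc_hbPiece_eq`), the trivial parts (`…ErrorTerms`) and the interior tuples
(`interior_tuple_bound`).  [cite: BombieriFriedlanderIwaniecActa1986, §15 (15.1) p. 244; §17 p. 249] -/
theorem sifted_sum_bound
    (h1 : BombieriFriedlanderIwaniecTheorem1) (h2 : BombieriFriedlanderIwaniecTheorem2)
    (h0b : BombieriFriedlanderIwaniecTheorem0b) (h5 : BombieriFriedlanderIwaniecTheorem5StarInterval)
    (hL3 : BombieriFriedlanderIwaniecLemma3) (hShiu : Shiu1980BrunTitchmarsh)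
    (hSWμ : LFunctions.SiegelWalfiszMoebius) (hFL : SieveSequence.fundamental_lemma_uniform)
    {a : ℤ} (ha : a ≠ 0) {ε : ℝ} (hε : 0 < ε) (hε' : ε ≤ 1 / 1000) {A : ℝ} (hA : 0 < A) :
    ∃ C x₀ : ℝ, ∀ x : ℝ, x₀ ≤ x → ∀ lam : ℕ → ℝ, IsWellFactorable (x ^ (4 / 7 - ε)) lam →
      |∑ q ∈ (Icc 1 ⌊x ^ (4 / 7 - ε)⌋₊).filter (fun q : ℕ => IsCoprime (q : ℤ) a),
          lam q * dyadDiscSifted q a (Real.exp (Real.sqrt (Real.log x))) x| ≤ C * x / Real.log x ^ A := by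
  obtain ⟨BE, CE, xE, hBE, hCE, hErr⟩ := sum_abs_sievedDisc_prodErr_le hL3 ha
  obtain ⟨BN, CN, xN, hBN, hCN, hNI⟩ := sum_abs_sievedDisc_prodMain_not_interior_le hShiu a
  set A₁ : ℝ := A + max BE BN + 3 with hA₁
  have hA₁1 : 1 ≤ A₁ := by rw [hA₁]; have := le_max_left BE BN; linarith
  set A₅ : ℝ := A + 14 * (A₁ + 1) + 3 with hA₅
  have hA₅0 : 0 ≤ A₅ := by rw [hA₅]; linarith
  obtain ⟨CI, xI, hCI, hI⟩ := interior_tuple_bound h1 h2 h0b h5 hL3 hShiu hSWμ hFL ha hε hε' hA₅0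
  obtain ⟨xP, hP⟩ := eventually_params hA₁1
  refine ⟨7 * 35 * (2 * 5 ^ 14 * CI + 2 * CN + CE), max xE (max xN (max xI xP)), fun x hx lam hlam => ?_⟩
  have hxE : xE ≤ x := le_trans (le_max_left _ _) hx
  have hxN : xN ≤ x := le_trans ((le_max_left _ _).trans (le_max_right _ _)) hx
  have hxI : xI ≤ x := le_trans ((le_max_left _ _).trans ((le_max_right _ _).trans (le_max_right _ _))) hx
  have hxP : xP ≤ x := le_trans ((le_max_right _ _).trans ((le_max_right _ _).trans (le_max_right _ _))) hx
  obtain ⟨hx2, hL1, hlog2x, hΔ0, hΔ28, hΔx, hU1, hU4, hU7, hKpow, hKle⟩ := hP x hxP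
  set L : ℝ := Real.log x with hL
  set Δ : ℝ := L ^ (-A₁) with hΔ
  set U : ℕ := 2 * ⌈x ^ (1 / 7 : ℝ)⌉₊ with hU
  set K : ℕ := ⌊2 * Real.log (2 * x) / Δ⌋₊ + 1 with hK
  set z : ℝ := Real.exp (Real.sqrt L) with hz
  set Dn : ℕ := ⌊x ^ (4 / 7 - ε)⌋₊ with hDn
  set F : Finset ℕ := (Icc 1 Dn).filter (fun q : ℕ => IsCoprime (q : ℤ) a) with hF
  have hx0 : 0 < x := by linarith
  have hx1 : (1 : ℝ) ≤ x := by linarith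
  have hL0 : 0 < L := by linarith
  have hΔ1 : Δ ≤ 1 := by linarith
  have hΔhalf : Δ ≤ 1 / 2 := by linarith
  have hΔ14 : (1 + Δ) ^ 14 ≤ 2 := one_add_pow_le_two hΔ0.le (by push_cast; linarith)
  have hDnx : (Dn : ℝ) ≤ x := (Nat.floor_le (Real.rpow_nonneg hx0.le _)).trans (by
    calc x ^ (4 / 7 - ε) ≤ x ^ (1 : ℝ) := Real.rpow_le_rpow_of_exponent_le hx1 (by linarith)
      _ = x := Real.rpow_one x)
  have hDn47 : (Dn : ℝ) ≤ x ^ (4 / 7 : ℝ) :=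
    (Nat.floor_le (Real.rpow_nonneg hx0.le _)).trans (Real.rpow_le_rpow_of_exponent_le hx1 (by linarith))
  have hlam1 : ∀ q, |lam q| ≤ 1 := hlam.1
  have hLc0 : 0 ≤ Real.log (2 * x) := Real.log_nonneg (by linarith)
  -- Heath-Brown's identity
  have hHB : ∀ q, dyadDiscSifted q a z x =
      ∑ j ∈ Icc 1 7, (-1 : ℝ) ^ (j + 1) * (Nat.choose 7 j : ℝ) * sievedDisc (fun n => hbPiece U j n) q a z x :=
    fun q => dyadDiscSifted_eq_sum_hbPiece hU7 q a z
  have hexp : ∑ q ∈ F, lam q * dyadDiscSifted q a z x =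
      ∑ j ∈ Icc 1 7, (-1 : ℝ) ^ (j + 1) * (Nat.choose 7 j : ℝ) *
        ∑ q ∈ F, lam q * sievedDisc (fun n => hbPiece U j n) q a z x := by
    calc ∑ q ∈ F, lam q * dyadDiscSifted q a z x
        = ∑ q ∈ F, ∑ j ∈ Icc 1 7, (-1 : ℝ) ^ (j + 1) * (Nat.choose 7 j : ℝ) *
            (lam q * sievedDisc (fun n => hbPiece U j n) q a z x) := by
          refine Finset.sum_congr rfl fun q _ => ?_
          rw [hHB q, Finset.mul_sum]
          exact Finset.sum_congr rfl fun j _ => by ring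
      _ = _ := by
          rw [Finset.sum_comm]
          exact Finset.sum_congr rfl fun j _ => by rw [Finset.mul_sum]
  -- the per-`j` bound
  have hperj : ∀ j ∈ Icc 1 7, |∑ q ∈ F, lam q * sievedDisc (fun n => hbPiece U j n) q a z x| ≤
      (2 * 5 ^ 14 * CI + 2 * CN + CE) * x / L ^ A := by
    intro j hj
    rw [Finset.mem_Icc] at hj
    have hS : ∀ q ∈ F, sievedDisc (fun n => hbPiece U j n) q a z x =
        ∑ κ ∈ tuples j K, (tupleConst x Δ j κ * sievedDisc (fun n => prodMain x z Δ U j κ n) q a z x +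
          sievedDisc (fun n => prodErr x z Δ U j κ n) q a z x) :=
      fun q _ => sievedDisc_hbPiece_eq hj.1 hx0 hΔ0 hKpow q a
    have hkey := abstract_piece_sum_bound F (tuples j K) (Interior x Δ j) lam
      (fun q => sievedDisc (fun n => hbPiece U j n) q a z x)
      (fun κ q => sievedDisc (fun n => prodMain x z Δ U j κ n) q a z x)
      (fun κ q => sievedDisc (fun n => prodErr x z Δ U j κ n) q a z x)
      (tupleConst x Δ j) hlam1 hS (fun κ _ => tupleConst_nonneg κ)
      (fun κ _ => tupleConst_le (by linarith) hΔ0.le κ) hLc0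
      (fun κ hκ hInt => hI x hxI Δ U j K κ lam hlam hj.1 hj.2 hΔ0 hΔhalf hΔ14 hU1 hU4 hκ hInt)
      (div_nonneg (mul_nonneg hCI hx0.le) (Real.rpow_nonneg hL0.le _))
      (hNI x hxN z Δ U j K Dn hj.1 hj.2 hΔx hΔ28 hDn47)
      (hErr x hxE z Δ U j K Dn hj.1 hj.2 hΔ0 hΔ1 hDnx)
    refine hkey.trans ?_
    -- the number of tuples
    have hTc : ((tuples j K).card : ℝ) ≤ 5 ^ 14 * L ^ (14 * (A₁ + 1)) := by
      have hcard : (tuples j K).card = K ^ (2 * j) := by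
        unfold tuples; rw [Fintype.card_piFinset, Finset.prod_const, Finset.card_range, Finset.card_univ,
          Fintype.card_fin]
      rw [hcard]
      push_cast
      have hK1 : (1 : ℝ) ≤ K := by rw [hK]; push_cast; have := Nat.cast_nonneg (α := ℝ) ⌊2 * Real.log (2 * x) / Δ⌋₊; linarith
      calc (K : ℝ) ^ (2 * j) ≤ (K : ℝ) ^ 14 := pow_le_pow_right₀ hK1 (by omega)
        _ ≤ (5 * L ^ (A₁ + 1)) ^ 14 := pow_le_pow_left₀ (by linarith) hKle 14
        _ = 5 ^ 14 * (L ^ (A₁ + 1)) ^ (14 : ℕ) := mul_pow _ _ _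
        _ = 5 ^ 14 * L ^ (14 * (A₁ + 1)) := by
            rw [← Real.rpow_natCast (L ^ (A₁ + 1)) 14, ← Real.rpow_mul hL0.le]; ring_nf
    exact perj_algebra hL1 hx0.le hCI hCN hCE hTc hLc0 hlog2x
  -- sum over `j`
  rw [hexp]
  calc |∑ j ∈ Icc 1 7, (-1 : ℝ) ^ (j + 1) * (Nat.choose 7 j : ℝ) *
          ∑ q ∈ F, lam q * sievedDisc (fun n => hbPiece U j n) q a z x|
      ≤ ∑ j ∈ Icc 1 7, |(-1 : ℝ) ^ (j + 1) * (Nat.choose 7 j : ℝ) *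
          ∑ q ∈ F, lam q * sievedDisc (fun n => hbPiece U j n) q a z x| := Finset.abs_sum_le_sum_abs _ _
    _ ≤ ∑ j ∈ Icc 1 7, 35 * ((2 * 5 ^ 14 * CI + 2 * CN + CE) * x / L ^ A) := by
        refine Finset.sum_le_sum fun j hj => ?_
        rw [abs_mul, abs_mul, abs_pow, abs_neg, abs_one, one_pow, one_mul, Nat.abs_cast]
        exact mul_le_mul (choose_seven_le j) (hperj j hj) (abs_nonneg _) (by norm_num)
    _ = 7 * 35 * (2 * 5 ^ 14 * CI + 2 * CN + CE) * x / Real.log x ^ A := by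
        rw [Finset.sum_const, Nat.card_Icc, nsmul_eq_mul]; push_cast; rw [← hL]; ring

end BFI
end Literature.NumberTheory.Sieve

namespace Literature.NumberTheory.Sieve
namespace BFI

/-- **The sifted dyadic form of Theorem 10 from the printed leaves.**
`Literature.NumberTheory.Sieve.BFI.Theorem10DyadicSifted` for the sifting level `z = exp(√log x)`,
derived from BFI's Theorems 0 (b), 1, 2, 5*, Lemma 3 (named facts), Shiu's theorem, the
Siegel–Walfisz theorem for `μ` and the fundamental lemma of the sieve, along §§15, 17 of the source.
(For `ε > 1/1000` the level `x^{4/7−ε}` is raised to `x^{4/7−1/1000}` by `IsWellFactorable.mono`.)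
[cite: BombieriFriedlanderIwaniecActa1986, §15 (15.1) p. 244; §17 p. 249] -/
theorem Theorem10DyadicSifted_of_leaves
    (h1 : BombieriFriedlanderIwaniecTheorem1) (h2 : BombieriFriedlanderIwaniecTheorem2)
    (h0b : BombieriFriedlanderIwaniecTheorem0b) (h5 : BombieriFriedlanderIwaniecTheorem5StarInterval)
    (hL3 : BombieriFriedlanderIwaniecLemma3) (hShiu : Shiu1980BrunTitchmarsh)
    (hSWμ : LFunctions.SiegelWalfiszMoebius) (hFL : SieveSequence.fundamental_lemma_uniform) :
    Theorem10DyadicSifted (fun x => Real.exp (Real.sqrt (Real.log x))) := by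
  intro a ha ε hε A hA
  set ε' : ℝ := min ε (1 / 1000) with hε'def
  have hε'0 : 0 < ε' := lt_min hε (by norm_num)
  have hε'1 : ε' ≤ 1 / 1000 := min_le_right _ _
  have hε'ε : ε' ≤ ε := min_le_left _ _
  obtain ⟨C, x₀, h⟩ := sifted_sum_bound h1 h2 h0b h5 hL3 hShiu hSWμ hFL ha hε'0 hε'1 hA
  refine ⟨max C 0, max x₀ 1, fun x hx lam hlam => ?_⟩
  have hx₀ : x₀ ≤ x := le_trans (le_max_left _ _) hx
  have hx1 : (1 : ℝ) ≤ x := le_trans (le_max_right _ _) hx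
  have hx0 : 0 < x := by linarith
  have hRHS : C * x / Real.log x ^ A ≤ max C 0 * x / Real.log x ^ A := by
    have : 0 ≤ x / Real.log x ^ A := div_nonneg hx0.le (Real.rpow_nonneg (Real.log_nonneg hx1) _)
    calc C * x / Real.log x ^ A = C * (x / Real.log x ^ A) := by ring
      _ ≤ max C 0 * (x / Real.log x ^ A) := mul_le_mul_of_nonneg_right (le_max_left _ _) this
      _ = _ := by ring
  have hRHS0 : 0 ≤ max C 0 * x / Real.log x ^ A :=
    div_nonneg (mul_nonneg (le_max_right _ _) hx0.le) (Real.rpow_nonneg (Real.log_nonneg hx1) _)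
  set D : ℝ := x ^ (4 / 7 - ε) with hD
  set D' : ℝ := x ^ (4 / 7 - ε') with hD'
  have hDD' : D ≤ D' := Real.rpow_le_rpow_of_exponent_le hx1 (by linarith)
  rcases lt_or_ge D 1 with hD1 | hD1
  · -- empty range of moduli
    have : ⌊D⌋₊ = 0 := Nat.floor_eq_zero.2 hD1
    rw [this]
    simp only [show (Icc 1 0 : Finset ℕ) = ∅ from rfl, Finset.filter_empty, Finset.sum_empty, abs_zero]
    exact hRHS0
  · have hlam' : IsWellFactorable D' lam := hlam.mono hD1 hDD'
    have hmain := h x hx₀ lam hlam'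
    -- the two ranges of moduli carry the same sum
    have hsub : (Icc 1 ⌊D⌋₊).filter (fun q : ℕ => IsCoprime (q : ℤ) a) ⊆
        (Icc 1 ⌊D'⌋₊).filter (fun q : ℕ => IsCoprime (q : ℤ) a) :=
      Finset.filter_subset_filter _ (Finset.Icc_subset_Icc le_rfl (Nat.floor_le_floor hDD'))
    have hsum : ∑ q ∈ (Icc 1 ⌊D⌋₊).filter (fun q : ℕ => IsCoprime (q : ℤ) a),
        lam q * dyadDiscSifted q a (Real.exp (Real.sqrt (Real.log x))) x =
        ∑ q ∈ (Icc 1 ⌊D'⌋₊).filter (fun q : ℕ => IsCoprime (q : ℤ) a),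
          lam q * dyadDiscSifted q a (Real.exp (Real.sqrt (Real.log x))) x := by
      refine Finset.sum_subset hsub fun q hq hq' => ?_
      have hq1 : q ∈ Icc 1 ⌊D'⌋₊ := (Finset.mem_filter.1 hq).1
      have hqD : ⌊D⌋₊ < q := by
        by_contra hle
        exact hq' (Finset.mem_filter.2 ⟨Finset.mem_Icc.2 ⟨(Finset.mem_Icc.1 hq1).1, not_lt.1 hle⟩,
          (Finset.mem_filter.1 hq).2⟩)
      rw [hlam.2.2.1 q (Nat.lt_of_floor_lt hqD), zero_mul]
    rw [hsum]
    exact hmain.trans hRHS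

end BFI

open BFI

/-- **BFI Theorem 10, dyadic form, from the leaves** (`Theorem10Dyadic_of_sifted` with
`z = exp(√log x) ≤ x`). [cite: BombieriFriedlanderIwaniecActa1986, §15 (15.1) p. 244] -/
theorem Theorem10Dyadic_of_leaves
    (h1 : BombieriFriedlanderIwaniecTheorem1) (h2 : BombieriFriedlanderIwaniecTheorem2)
    (h0b : BombieriFriedlanderIwaniecTheorem0b) (h5 : BombieriFriedlanderIwaniecTheorem5StarInterval)
    (hL3 : BombieriFriedlanderIwaniecLemma3) (hShiu : Shiu1980BrunTitchmarsh)
    (hSWμ : LFunctions.SiegelWalfiszMoebius) (hFL : SieveSequence.fundamental_lemma_uniform) :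
    Theorem10Dyadic := by
  refine Theorem10Dyadic_of_sifted (z := fun x => Real.exp (Real.sqrt (Real.log x))) ?_
    (Theorem10DyadicSifted_of_leaves h1 h2 h0b h5 hL3 hShiu hSWμ hFL)
  filter_upwards [Filter.eventually_ge_atTop (Real.exp 1)] with x hx
  have hx0 : 0 < x := (Real.exp_pos 1).trans_le hx
  have hL1 : 1 ≤ Real.log x := by rwa [Real.le_log_iff_exp_le hx0]
  have hsq : Real.sqrt (Real.log x) ≤ Real.log x := by
    rw [Real.sqrt_le_left (by linarith)]
    nlinarith
  calc Real.exp (Real.sqrt (Real.log x)) ≤ Real.exp (Real.log x) := Real.exp_le_exp.2 hsq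
    _ = x := Real.exp_log hx0

/-- **BFI Theorem 10 (as printed) from the leaves**, adding the prime number theorem with the
de la Vallée Poussin error term for the passage from the dyadic to the `ψ`-form
(`BombieriFriedlanderIwaniecTheorem10_of_dyadic`). [cite: BombieriFriedlanderIwaniecActa1986, Theorem 10] -/
theorem BombieriFriedlanderIwaniecTheorem10_of_leaves
    (h1 : BombieriFriedlanderIwaniecTheorem1) (h2 : BombieriFriedlanderIwaniecTheorem2)
    (h0b : BombieriFriedlanderIwaniecTheorem0b) (h5 : BombieriFriedlanderIwaniecTheorem5StarInterval)
    (hL3 : BombieriFriedlanderIwaniecLemma3) (hShiu : Shiu1980BrunTitchmarsh)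
    (hSWμ : LFunctions.SiegelWalfiszMoebius) (hFL : SieveSequence.fundamental_lemma_uniform)
    (hψ : LFunctions.ChebyshevPsiDeLaValleePoussin) :
    BombieriFriedlanderIwaniecTheorem10 :=
  BombieriFriedlanderIwaniecTheorem10_of_dyadic (Theorem10Dyadic_of_leaves h1 h2 h0b h5 hL3 hShiu hSWμ hFL) hψ

/-- **The tree's fact `bfi_wellFactorable_level` from the leaves** (the DAG under BFI Theorem 10
closed up to the printed deep theorems of the source — Theorems 0 (b), 1, 2, 5*, Lemma 3 — and the
classical inputs Shiu 1980, Siegel–Walfisz for `μ`, the fundamental lemma, and the prime number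
theorem with the de la Vallée Poussin error term; all of these are named facts, D-0014).
[cite: BombieriFriedlanderIwaniecActa1986, Theorem 10] -/
theorem bfi_wellFactorable_level_of_leaves
    (h1 : BombieriFriedlanderIwaniecTheorem1) (h2 : BombieriFriedlanderIwaniecTheorem2)
    (h0b : BombieriFriedlanderIwaniecTheorem0b) (h5 : BombieriFriedlanderIwaniecTheorem5StarInterval)
    (hL3 : BombieriFriedlanderIwaniecLemma3) (hShiu : Shiu1980BrunTitchmarsh)
    (hSWμ : LFunctions.SiegelWalfiszMoebius) (hFL : SieveSequence.fundamental_lemma_uniform)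
    (hψ : LFunctions.ChebyshevPsiDeLaValleePoussin) :
    bfi_wellFactorable_level :=
  bfi_wellFactorable_level_of_theorem10
    (BombieriFriedlanderIwaniecTheorem10_of_leaves h1 h2 h0b h5 hL3 hShiu hSWμ hFL hψ)

end Literature.NumberTheory.Sieve
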